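import Literature.NumberTheory.NumberFields.ImaginaryAbelianClassGroupOddPartBernoulliSubfieldProofs
import Literature.NumberTheory.GaussSums.StickelbergerSubfieldAnnihilation
import HarnessLib

/-!
# The Herbrand–Stickelberger direction of Mazur–Wiles' Theorem 2 for EVERY subfield `K ⊆ ℚ(μ_f)`,
# without any hypothesis on `[ℚ(μ_f) : K]`: Stickelberger's theorem descended to `K` (Washington Thm. 6.10)

Topic `Literature/NumberTheory/NumberFields`, namespace `Literature.NumberTheory.NumberFields`
(helpers in `StickelbergerHerbrand`). THEOREMS ONLY: no definition, no named fact, no `sorry`, no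
instance, no notation (D-0014 ∕ D-0026: net Literature debt 0). Fourth file of the series
`ImaginaryAbelianClassGroupOddPartBernoulli{Proofs, SubfieldProofs, TowerProofs}.lean`. The second file
treated `K ⊆ ℚ(μ_f)` by transporting the `ℚ(μ_f)`-statement along the extension map of class groups,
which needs `p ∤ [ℚ(μ_f) : K]`; here that hypothesis is REMOVED by using instead the tree's
Stickelberger theorem FOR `K` ITSELF (`GaussSums/StickelbergerSubfieldAnnihilation.lean`,
`JacobiSumIdeal.mk0_prod_comap_pow_stickelberger_subfield_eq_one`: the restriction of `(b − σ_b)θ(f)` to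
`K` annihilates `Cl(K)`, Washington Thm. 6.10 ∕ Lang Thm. 2.3 descended with Jacobi sums). This covers the
cyclic fields `K = ℚ(μ_f)^{ker χ}` cut out by a character of conductor `f` with `p ∣ φ(f)` (e.g.
`ℚ(√−11) ⊂ ℚ(μ_{11})`, `p = 5`), which no transport in degree prime to `p` reaches. HONEST FRAMING:
still Stickelberger–Herbrand, not Mazur–Wiles: the named fact
`MazurWiles1984.thm2_oddChiPart_classGroup_card_eq_pow_val_bernoulli` is NOT discharged (its other half,
`p^{v_p(B_{1,χ⁻¹})} ∣ #A^θ`, is the Main Conjecture); no summit statement (BSD) and no conjunct of one is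
proved; nothing is claimed for fields not presented inside `ℚ(μ_f)`, `f` the modulus of `χ`.

## Sources, verbatim

S. Lang, *Cyclotomic Fields I and II*, GTM 121, Ch. 1 §2 Thm. 2.3 («for all `b` prime to `m`,
`(b − σ_b)θ(m)` annihilates `𝒞`»), §3 Thm. 3.1 («For non-trivial `χ`, the ideal `B_{1,χ̄} I_χ`
annihilates `𝒞^{(p)}(χ)`»), Lemma 1 (ii) («If `χ` is non-trivial and not equal to the Teichmuller
character, then `I_χ = (1)`»). L. C. Washington, *Introduction to Cyclotomic Fields*, GTM 83, Thm. 6.10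
(cite-only, acq-01236): the Stickelberger ideal of an abelian `K ⊆ ℚ(ζ_m)` annihilates `Cl(K)` — in the tree
as `JacobiSumIdeal.mk0_prod_comap_pow_stickelberger_subfield_eq_one`: for `K₁ ⊆ M = ℚ(μ_m)`, `b < m` and every
non-zero ideal `𝔟` of `𝓞 K₁`, `[∏_τ (τ⁻¹𝔟)^{E_b(τ)}] = 1` with `E_b(τ) = Σ_{σ ∈ Gal(M/ℚ), σ|_{K₁} = τ} ⌊b·c(σ)/m⌋`.
D. Solomon, Ann. Inst. Fourier 40 (1990), Rem. II.1 (a) p. 472: «Stickelberger's Theorem shows that it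
annihilates `(Cl(K) ⊗ 𝓞)^χ` which allows us to deduce Theorem II.1 in this case».

## What is proved

`K₁ ⊆ M = ℚ(μ_f)` number fields (`[Algebra K₁ M]`, `IsCyclotomicExtension {f} ℚ M`), `K₁/ℚ` Galois,
`θ₁ : Gal(K₁/ℚ) →* ℤ_pˣ`, `χ` a Dirichlet character mod `f` with values in `ℚ_p`.
* §1 `prod_mulEquiv_pow_stickelberger_subfield_eq_one` — the tree's descended Stickelberger relation read
  on classes with the action `ClassGroup.mulEquiv (AmbiguousClass.intAut τ)`; `…smul_classGroupRep…`,
  `…pClassGroupRep…` — additively and on `ℤ_p ⊗ Cl K₁`; `smul_eq_zero_of_mem_classGroupChiComponent_subfield`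
  — on the `θ₁`-component the scalar `s_b = Σ_τ E_b(τ) θ₁(τ⁻¹)` kills.
* §2 `sum_fiber_mul_eq` — `Σ_τ E_b(τ) θ₁(τ⁻¹) = Σ_{σ ∈ Gal(M/ℚ)} ⌊b·c(σ)/f⌋ θ₁(σ⁻¹|_{K₁})`, the scalar of the
  FIRST file for `M` and `θ_M = θ₁ ∘ (σ ↦ σ|_{K₁})`; hence (`coe_sum_fiber_mul_eq`) it is
  `(b − χ(b))·B_{1,χ⁻¹}` in `ℚ_p` when `χ` is the Dirichlet avatar of `θ₁` (first file §2, §4; second file §1).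
* §3 `classGroupChiCard_eq_one_of_norm_generalizedBernoulli_eq_one_subfield` (and the primed forms `…'`,
  which ask for the avatar only on the inflation `θ_M` of `θ₁` to `Gal(ℚ(μ_f)/ℚ)`) — if some `b < f` prime to
  `f` has `‖χ(b) − b‖_p = 1` and `‖B_{1,χ⁻¹}‖_p = 1` then `#e_{θ₁}(ℤ_p ⊗ Cl K₁) = 1`; and the consumers'
  form `classGroupChiCard_eq_one_of_norm_generalizedBernoulli_eq_one_subfield_of_odd` with the hypotheses
  of the named fact VERBATIM (`p ∤ [K₁:ℚ]`, `χ` primitive, odd, «`χ ≠ ω`») — Lang's Lemma 1 (ii) producing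
  `b < f` (for `p ∤ f` take `b = f − 1`: `χ(−1) = −1`; for `p ∣ f` the units `≡ 1 (mod p)`; the values of
  `χ` are values of `θ₁`, of order dividing `[K₁:ℚ]`, prime to `p`).

## References

* [Lang1990] Ch. 1 §2 Thm. 2.3, §3 Lemma 1, Thm. 3.1, Cor. 1–3. [Washington1997] Thm. 6.10 (cite-only).
* [Solomon1990] §I p. 467–468, §II.2 p. 471, Rem. II.1 (a) p. 472.
* Tree: `GaussSums/StickelbergerSubfieldAnnihilation.lean` (`mk0_prod_comap_pow_stickelberger_subfield_eq_one`),
  the three previous files of this series, `ClassGroupUnitsGaloisModules.lean`, `AmbiguousClassGaloisAction.lean`.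
-/

noncomputable section

open NumberField IsDedekindDomain
open scoped TensorProduct nonZeroDivisors Classical
open Literature.RepresentationTheory.FiniteGroups
open Literature.NumberTheory.LFunctions (generalizedBernoulli)

namespace Literature.NumberTheory.NumberFields

namespace StickelbergerHerbrand

variable {p : ℕ} [Fact p.Prime] {f : ℕ} [NeZero f] {K₁ M : Type} [Field K₁] [NumberField K₁]
  [Field M] [NumberField M] [Algebra K₁ M] [IsGalois ℚ K₁] [hM : IsCyclotomicExtension {f} ℚ M]

/-! ## §1 The descended Stickelberger relation on `Cl K₁`, on `ℤ_p ⊗ Cl K₁`, on the `θ₁`-component -/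

omit [NumberField M] [Algebra K₁ M] [IsGalois ℚ K₁] hM in
/-- `τ⁻¹𝔟 = 𝔟.comap τ` is the image of `𝔟` under the ring automorphism of `𝓞 K₁` induced by `τ⁻¹`.
[folklore] -/
private theorem comap_mapRingEquiv_eq_map_inv (τ : K₁ ≃ₐ[ℚ] K₁) (I : Ideal (𝓞 K₁)) :
    I.comap (RingOfIntegers.mapRingEquiv (τ : K₁ ≃+* K₁)) =
      I.map (AmbiguousClass.intAut τ⁻¹ : 𝓞 K₁ →+* 𝓞 K₁) := by
  rw [Ideal.map_coe, ← Ideal.map_symm]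
  congr 1

omit [NumberField M] [Algebra K₁ M] [IsGalois ℚ K₁] hM in
/-- `τ⁻¹𝔟 ≠ 0` for `𝔟 ≠ 0`. [folklore] -/
private theorem comap_mapRingEquiv_ne_bot (τ : K₁ ≃ₐ[ℚ] K₁) {I : Ideal (𝓞 K₁)} (hI : I ≠ ⊥) :
    I.comap (RingOfIntegers.mapRingEquiv (τ : K₁ ≃+* K₁)) ≠ ⊥ := by
  rw [Ne, ← Ideal.map_symm,
    Ideal.map_eq_bot_iff_of_injective (RingOfIntegers.mapRingEquiv (τ : K₁ ≃+* K₁)).symm.injective]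
  exact hI

omit [NumberField M] [Algebra K₁ M] [IsGalois ℚ K₁] hM in
/-- `τ⁻¹[𝔟] = [τ⁻¹𝔟] = [𝔟.comap τ]` in `Cl K₁`. [folklore] -/
private theorem mulEquiv_intAut_inv_mk0 (τ : K₁ ≃ₐ[ℚ] K₁) (I : (Ideal (𝓞 K₁))⁰) :
    ClassGroup.mulEquiv (AmbiguousClass.intAut τ⁻¹) (ClassGroup.mk0 I) =
      ClassGroup.mk0 ⟨(I : Ideal (𝓞 K₁)).comap (RingOfIntegers.mapRingEquiv (τ : K₁ ≃+* K₁)),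
        mem_nonZeroDivisors_iff_ne_zero.mpr
          (comap_mapRingEquiv_ne_bot τ (nonZeroDivisors.ne_zero I.2))⟩ := by
  rw [AmbiguousClass.mulEquiv_mk0]
  congr 1
  exact Subtype.ext (comap_mapRingEquiv_eq_map_inv τ I).symm

/-- **Stickelberger's theorem descended to `K₁ ⊆ ℚ(μ_f)`, on ideal CLASSES** (Washington Thm. 6.10 ∕
Lang Thm. 2.3 via the tree's `mk0_prod_comap_pow_stickelberger_subfield_eq_one`): for `b < f` and every
class `C` of `K₁`, `Π_τ (τ⁻¹C)^{E_b(τ)} = 1` with `E_b(τ) = Σ_{σ ∈ Gal(ℚ(μ_f)/ℚ), σ|_{K₁} = τ} ⌊b·c(σ)/f⌋`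
(the coefficient of `τ⁻¹` in the restriction of `(b − σ_b)θ(f)`), `τ` acting by
`ClassGroup.mulEquiv (intAut τ)`. [cite: Washington1997, Thm. 6.10] [cite: Lang1990, Ch. 1 §2 Thm. 2.3] -/
theorem prod_mulEquiv_pow_stickelberger_subfield_eq_one [IsGalois K₁ M] {b : ℕ} (hb : b < f)
    (C : ClassGroup (𝓞 K₁)) :
    ∏ τ : K₁ ≃ₐ[ℚ] K₁, (ClassGroup.mulEquiv (AmbiguousClass.intAut τ⁻¹) C) ^
      (∑ σ ∈ Finset.univ.filter (fun σ : M ≃ₐ[ℚ] M => σ.restrictNormal K₁ = τ),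
        b * ((IsCyclotomicExtension.Rat.galEquivZMod f M σ : (ZMod f)ˣ) : ZMod f).val / f) = 1 := by
  obtain ⟨I, rfl⟩ := ClassGroup.mk0_surjective C
  have hI : (I : Ideal (𝓞 K₁)) ≠ ⊥ := nonZeroDivisors.ne_zero I.2
  simp_rw [mulEquiv_intAut_inv_mk0, ← map_pow]
  rw [← map_prod, ← Literature.NumberTheory.GaussSums.JacobiSumIdeal.mk0_prod_comap_pow_stickelberger_subfield_eq_one
    (m := f) (M := M) hb hI]
  congr 1
  refine Subtype.ext ?_
  rw [Submonoid.coe_finsetProd]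
  exact Finset.prod_congr rfl fun τ _ => rfl

/-- The same additively in the integral representation `classGroupRep ℚ K₁`:
`Σ_τ E_b(τ) · (τ⁻¹ c) = 0`. [cite: Washington1997, Thm. 6.10] [cite: Lang1990, Ch. 1 §2 Thm. 2.3] -/
theorem sum_fiber_smul_classGroupRep_inv_eq_zero [IsGalois K₁ M] {b : ℕ} (hb : b < f)
    (C : ClassGroup (𝓞 K₁)) :
    ∑ τ : K₁ ≃ₐ[ℚ] K₁,
      (∑ σ ∈ Finset.univ.filter (fun σ : M ≃ₐ[ℚ] M => σ.restrictNormal K₁ = τ),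
        b * ((IsCyclotomicExtension.Rat.galEquivZMod f M σ : (ZMod f)ˣ) : ZMod f).val / f) •
        classGroupRep ℚ K₁ τ⁻¹ (Additive.ofMul C) = 0 := by
  have h := congrArg Additive.ofMul (prod_mulEquiv_pow_stickelberger_subfield_eq_one (M := M) hb C)
  rw [ofMul_prod, ofMul_one] at h
  simp_rw [ofMul_pow] at h
  simp_rw [classGroupRep_apply]
  exact h

/-- The same on `ℤ_p ⊗ Cl K₁`. [cite: Lang1990, Ch. 1 §3 Thm. 3.1 (reformulation of Thm. 2.3 on 𝒞^{(p)})] -/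
theorem sum_fiber_smul_pClassGroupRep_inv_eq_zero [IsGalois K₁ M] {b : ℕ} (hb : b < f)
    (x : ℤ_[p] ⊗[ℤ] Additive (ClassGroup (𝓞 K₁))) :
    ∑ τ : K₁ ≃ₐ[ℚ] K₁,
      (∑ σ ∈ Finset.univ.filter (fun σ : M ≃ₐ[ℚ] M => σ.restrictNormal K₁ = τ),
        b * ((IsCyclotomicExtension.Rat.galEquivZMod f M σ : (ZMod f)ˣ) : ZMod f).val / f) •
        pClassGroupRep ℚ K₁ p τ⁻¹ x = 0 := by
  induction x using TensorProduct.induction_on with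
  | zero => simp
  | tmul a c =>
    obtain ⟨C, rfl⟩ := Additive.ofMul.surjective c
    have hmk : ∀ (n : ℕ) (y : Additive (ClassGroup (𝓞 K₁))),
        n • (a ⊗ₜ[ℤ] y) = TensorProduct.mk ℤ ℤ_[p] (Additive (ClassGroup (𝓞 K₁))) a (n • y) :=
      fun n y => by rw [map_nsmul]; rfl
    simp_rw [baseChangeRep_apply_tmul, hmk]
    rw [← map_sum, sum_fiber_smul_classGroupRep_inv_eq_zero (M := M) hb C, map_zero]
  | add x y hx hy =>
    simp_rw [map_add, smul_add, Finset.sum_add_distrib, hx, hy, add_zero]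

/-- **On the `θ₁`-component the scalar `s_b = Σ_τ E_b(τ) θ₁(τ⁻¹)` kills** («`(b − σ_b)θ` annihilates»,
read on the eigenspace `A(χ)`). [cite: Lang1990, Ch. 1 §3 Thm. 3.1] [cite: Washington1997, Thm. 6.10] -/
theorem smul_eq_zero_of_mem_classGroupChiComponent_subfield [IsGalois K₁ M] (θ₁ : (K₁ ≃ₐ[ℚ] K₁) →* ℤ_[p]ˣ)
    {b : ℕ} (hb : b < f) {x : ℤ_[p] ⊗[ℤ] Additive (ClassGroup (𝓞 K₁))}
    (hx : x ∈ classGroupChiComponent ℚ K₁ p (fun g => ((θ₁ g : ℤ_[p]ˣ) : ℤ_[p]))) :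
    (∑ τ : K₁ ≃ₐ[ℚ] K₁,
      ((∑ σ ∈ Finset.univ.filter (fun σ : M ≃ₐ[ℚ] M => σ.restrictNormal K₁ = τ),
        b * ((IsCyclotomicExtension.Rat.galEquivZMod f M σ : (ZMod f)ˣ) : ZMod f).val / f : ℕ) : ℤ_[p]) *
        ((θ₁ τ⁻¹ : ℤ_[p]ˣ) : ℤ_[p])) • x = 0 := by
  have heig : ∀ g : K₁ ≃ₐ[ℚ] K₁, pClassGroupRep ℚ K₁ p g x = ((θ₁ g : ℤ_[p]ˣ) : ℤ_[p]) • x := by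
    obtain ⟨w, rfl⟩ := (mem_chiComponent_iff _ _ _).mp hx
    exact fun g => apply_charProjector_character _ θ₁ g w
  rw [Finset.sum_smul]
  calc ∑ τ : K₁ ≃ₐ[ℚ] K₁,
        (((∑ σ ∈ Finset.univ.filter (fun σ : M ≃ₐ[ℚ] M => σ.restrictNormal K₁ = τ),
          b * ((IsCyclotomicExtension.Rat.galEquivZMod f M σ : (ZMod f)ˣ) : ZMod f).val / f : ℕ) :
            ℤ_[p]) * ((θ₁ τ⁻¹ : ℤ_[p]ˣ) : ℤ_[p])) • x
      = ∑ τ : K₁ ≃ₐ[ℚ] K₁,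
          (∑ σ ∈ Finset.univ.filter (fun σ : M ≃ₐ[ℚ] M => σ.restrictNormal K₁ = τ),
            b * ((IsCyclotomicExtension.Rat.galEquivZMod f M σ : (ZMod f)ˣ) : ZMod f).val / f) •
            pClassGroupRep ℚ K₁ p τ⁻¹ x := by
        refine Finset.sum_congr rfl fun τ _ => ?_
        rw [mul_smul, ← heig τ⁻¹, Nat.cast_smul_eq_nsmul]
    _ = 0 := sum_fiber_smul_pClassGroupRep_inv_eq_zero (M := M) hb x

/-! ## §2 The scalar is the one of `ℚ(μ_f)`: `Σ_τ E_b(τ) θ₁(τ⁻¹) = Σ_σ ⌊b·c(σ)/f⌋ θ₁(σ⁻¹|_{K₁})` -/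

omit hM in
/-- Regrouping along the fibres of `σ ↦ σ|_{K₁}`:
`Σ_τ (Σ_{σ|_{K₁} = τ} n(σ)) θ₁(τ⁻¹) = Σ_σ n(σ) θ₁((σ|_{K₁})⁻¹)`. [folklore] -/
private theorem sum_fiber_mul_eq (θ₁ : (K₁ ≃ₐ[ℚ] K₁) →* ℤ_[p]ˣ) (n : (M ≃ₐ[ℚ] M) → ℕ) :
    ∑ τ : K₁ ≃ₐ[ℚ] K₁,
      ((∑ σ ∈ Finset.univ.filter (fun σ : M ≃ₐ[ℚ] M => σ.restrictNormal K₁ = τ), n σ : ℕ) : ℤ_[p]) *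
        ((θ₁ τ⁻¹ : ℤ_[p]ˣ) : ℤ_[p]) =
      ∑ σ : M ≃ₐ[ℚ] M, (n σ : ℤ_[p]) *
        ((θ₁.comp (AlgEquiv.restrictNormalHom (K₁ := M) K₁) σ⁻¹ : ℤ_[p]ˣ) : ℤ_[p]) := by
  rw [← Finset.sum_fiberwise_of_maps_to (s := Finset.univ) (t := Finset.univ)
    (g := fun σ : M ≃ₐ[ℚ] M => σ.restrictNormal K₁) (fun _ _ => Finset.mem_univ _)]
  refine Finset.sum_congr rfl fun τ _ => ?_
  rw [Nat.cast_sum, Finset.sum_mul]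
  refine Finset.sum_congr rfl fun σ hσ => ?_
  have hres : AlgEquiv.restrictNormalHom (K₁ := M) K₁ σ = σ.restrictNormal K₁ := rfl
  simp only [MonoidHom.comp_apply, map_inv, hres, (Finset.mem_filter.mp hσ).2]

/-- **The scalar in `ℚ_p`, avatar on `ℚ(μ_f)`:** if `χ` mod `f` is the Dirichlet avatar of the
INFLATED character `θ_M = θ₁ ∘ (σ ↦ σ|_{K₁})` of `Gal(M/ℚ)`, `M = ℚ(μ_f)` (`IsDirichletAvatar M θ_M χ m` —
weaker than an avatar on `K₁`, second file §1), `χ ≠ 1` and `b` is prime to `f`, then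
`Σ_τ E_b(τ) θ₁(τ⁻¹) = (b − χ(b))·B_{1,χ⁻¹}` (first file §2, §4 for `M` and `θ_M`).
[cite: Lang1990, Ch. 1 §3 Thm. 3.1 (B_{1,χ̄} I_χ)] [cite: Solomon1990, §II.2 p. 471, Rem. II.1 (a) p. 472] -/
theorem coe_sum_fiber_mul_eq_of_isDirichletAvatar_cyclotomic (θ₁ : (K₁ ≃ₐ[ℚ] K₁) →* ℤ_[p]ˣ)
    (χ : DirichletCharacter ℚ_[p] f) {m : ℕ}
    (hθχ : IsDirichletAvatar M (θ₁.comp (AlgEquiv.restrictNormalHom (K₁ := M) K₁)) χ m)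
    (hχ1 : χ ≠ 1) {b : ℕ} (hb : b.Coprime f) :
    ((∑ τ : K₁ ≃ₐ[ℚ] K₁,
      ((∑ σ ∈ Finset.univ.filter (fun σ : M ≃ₐ[ℚ] M => σ.restrictNormal K₁ = τ),
        b * ((IsCyclotomicExtension.Rat.galEquivZMod f M σ : (ZMod f)ˣ) : ZMod f).val / f : ℕ) : ℤ_[p]) *
        ((θ₁ τ⁻¹ : ℤ_[p]ˣ) : ℤ_[p]) : ℤ_[p]) : ℚ_[p]) =
      ((b : ℚ_[p]) - χ (b : ZMod f)) * generalizedBernoulli 1 χ⁻¹ := by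
  rw [sum_fiber_mul_eq]
  exact coe_sum_floor_mul_eq (θ₁.comp (AlgEquiv.restrictNormalHom (K₁ := M) K₁)) χ hθχ hχ1 hb

/-- **The scalar in `ℚ_p`:** if `χ` mod `f` is the Dirichlet avatar of `θ₁` (`IsDirichletAvatar K₁ θ₁ χ m`),
`χ ≠ 1` and `b` is prime to `f`, then `Σ_τ E_b(τ) θ₁(τ⁻¹) = (b − χ(b))·B_{1,χ⁻¹}` — the scalar of the first
file for `ℚ(μ_f)` and `θ_M = θ₁ ∘ (σ ↦ σ|_{K₁})`, whose Dirichlet avatar is again `χ` (second file §1).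
[cite: Lang1990, Ch. 1 §3 Thm. 3.1 (B_{1,χ̄} I_χ)] [cite: Solomon1990, §II.2 p. 471, Rem. II.1 (a) p. 472] -/
theorem coe_sum_fiber_mul_eq (θ₁ : (K₁ ≃ₐ[ℚ] K₁) →* ℤ_[p]ˣ) (χ : DirichletCharacter ℚ_[p] f)
    {m : ℕ} (hθχ : IsDirichletAvatar K₁ θ₁ χ m) (hχ1 : χ ≠ 1) {b : ℕ} (hb : b.Coprime f) :
    ((∑ τ : K₁ ≃ₐ[ℚ] K₁,
      ((∑ σ ∈ Finset.univ.filter (fun σ : M ≃ₐ[ℚ] M => σ.restrictNormal K₁ = τ),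
        b * ((IsCyclotomicExtension.Rat.galEquivZMod f M σ : (ZMod f)ˣ) : ZMod f).val / f : ℕ) : ℤ_[p]) *
        ((θ₁ τ⁻¹ : ℤ_[p]ˣ) : ℤ_[p]) : ℤ_[p]) : ℚ_[p]) =
      ((b : ℚ_[p]) - χ (b : ZMod f)) * generalizedBernoulli 1 χ⁻¹ :=
  coe_sum_fiber_mul_eq_of_isDirichletAvatar_cyclotomic θ₁ χ
    (isDirichletAvatar_comp_restrictNormalHom θ₁ χ hθχ) hχ1 hb

end StickelbergerHerbrand

/-! ## §3 The Herbrand–Stickelberger direction for every subfield of `ℚ(μ_f)` -/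

section CyclotomicSubfield

open StickelbergerHerbrand

variable {p : ℕ} [Fact p.Prime] {f : ℕ} [NeZero f] {K₁ : Type} [Field K₁] [NumberField K₁] [IsGalois ℚ K₁]

/-- **The Herbrand–Stickelberger direction for `K₁ ⊆ ℚ(μ_f)`, avatar on `ℚ(μ_f)`.** `K₁ ⊆ M = ℚ(μ_f)`
number fields, `K₁/ℚ` Galois, `θ₁ : Gal(K₁/ℚ) →* ℤ_pˣ` whose INFLATION `θ_M = θ₁ ∘ (σ ↦ σ|_{K₁})` to
`Gal(M/ℚ)` has the Dirichlet avatar `χ` mod `f` (`IsDirichletAvatar M θ_M χ m`; weaker than an avatar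
on `K₁` itself, and the form in which the avatar is available when `K₁` is cut out of a bigger field),
`χ ≠ 1`; if some `b < f` prime to `f` has `‖χ(b) − b‖_p = 1` and `‖B_{1,χ⁻¹}‖_p = 1`, then
`#e_{θ₁}(ℤ_p ⊗ Cl K₁) = 1`. Stickelberger's theorem for `K₁` (Washington Thm. 6.10) on the
`θ₁`-eigenspace (Lang Thm. 3.1). [cite: Lang1990, Ch. 1 §3 Thm. 3.1, Lemma 1 (ii)] [cite: Washington1997, Thm. 6.10]
[cite: Solomon1990, Rem. II.1 (a) p. 472] -/
theorem classGroupChiCard_eq_one_of_norm_generalizedBernoulli_eq_one_subfield'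
    (M : Type) [Field M] [NumberField M] [Algebra K₁ M] [IsCyclotomicExtension {f} ℚ M]
    (θ₁ : (K₁ ≃ₐ[ℚ] K₁) →* ℤ_[p]ˣ) (χ : DirichletCharacter ℚ_[p] f) (m : ℕ)
    (hθχ : IsDirichletAvatar M (θ₁.comp (AlgEquiv.restrictNormalHom (K₁ := M) K₁)) χ m)
    (hχ1 : χ ≠ 1)
    (hb : ∃ b : ℕ, b < f ∧ b.Coprime f ∧ ‖χ (b : ZMod f) - (b : ℚ_[p])‖ = 1)
    (hB : ‖(generalizedBernoulli 1 χ⁻¹ : ℚ_[p])‖ = 1) :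
    classGroupChiCard ℚ K₁ p (fun g => ((θ₁ g : ℤ_[p]ˣ) : ℤ_[p])) = 1 := by
  haveI : IsGalois ℚ M := IsCyclotomicExtension.isGalois {f} ℚ M
  haveI : IsGalois K₁ M := IsGalois.tower_top_of_isGalois ℚ K₁ M
  obtain ⟨b, hbf, hbcop, hbχ⟩ := hb
  set s : ℤ_[p] := ∑ τ : K₁ ≃ₐ[ℚ] K₁,
      ((∑ σ ∈ Finset.univ.filter (fun σ : M ≃ₐ[ℚ] M => σ.restrictNormal K₁ = τ),
        b * ((IsCyclotomicExtension.Rat.galEquivZMod f M σ : (ZMod f)ˣ) : ZMod f).val / f : ℕ) : ℤ_[p]) *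
        ((θ₁ τ⁻¹ : ℤ_[p]ˣ) : ℤ_[p]) with hsdef
  have hs : (s : ℚ_[p]) = ((b : ℚ_[p]) - χ (b : ZMod f)) * generalizedBernoulli 1 χ⁻¹ :=
    coe_sum_fiber_mul_eq_of_isDirichletAvatar_cyclotomic (M := M) θ₁ χ hθχ hχ1 hbcop
  have hsu : IsUnit s := by
    rw [PadicInt.isUnit_iff, ← PadicInt.padic_norm_e_of_padicInt, hs, norm_mul, hB, mul_one,
      ← norm_neg, neg_sub, hbχ]
  have hbot : classGroupChiComponent ℚ K₁ p (fun g => ((θ₁ g : ℤ_[p]ˣ) : ℤ_[p])) = ⊥ := by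
    rw [Submodule.eq_bot_iff]
    intro x hx
    exact (hsu.smul_eq_zero).mp (smul_eq_zero_of_mem_classGroupChiComponent_subfield (M := M) θ₁ hbf hx)
  rw [classGroupChiCard, hbot]
  exact Nat.card_unique

/-- **The Herbrand–Stickelberger direction for EVERY `K₁ ⊆ ℚ(μ_f)`** (no hypothesis on `[ℚ(μ_f) : K₁]`):
`K₁ ⊆ M = ℚ(μ_f)` number fields, `K₁/ℚ` Galois, `θ₁ : Gal(K₁/ℚ) →* ℤ_pˣ` with Dirichlet avatar `χ` mod
`f` (`IsDirichletAvatar K₁ θ₁ χ m`), `χ ≠ 1`; if some `b < f` prime to `f` has `‖χ(b) − b‖_p = 1` and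
`‖B_{1,χ⁻¹}‖_p = 1`, then `#e_{θ₁}(ℤ_p ⊗ Cl K₁) = 1`. Stickelberger's theorem for `K₁` itself
(Washington Thm. 6.10, tree `mk0_prod_comap_pow_stickelberger_subfield_eq_one`) read on the
`θ₁`-eigenspace (Lang Thm. 3.1). [cite: Lang1990, Ch. 1 §3 Thm. 3.1, Lemma 1 (ii)] [cite: Washington1997, Thm. 6.10]
[cite: Solomon1990, Rem. II.1 (a) p. 472] -/
theorem classGroupChiCard_eq_one_of_norm_generalizedBernoulli_eq_one_subfield
    (M : Type) [Field M] [NumberField M] [Algebra K₁ M] [IsCyclotomicExtension {f} ℚ M]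
    (θ₁ : (K₁ ≃ₐ[ℚ] K₁) →* ℤ_[p]ˣ) (χ : DirichletCharacter ℚ_[p] f) (m : ℕ)
    (hθχ : IsDirichletAvatar K₁ θ₁ χ m) (hχ1 : χ ≠ 1)
    (hb : ∃ b : ℕ, b < f ∧ b.Coprime f ∧ ‖χ (b : ZMod f) - (b : ℚ_[p])‖ = 1)
    (hB : ‖(generalizedBernoulli 1 χ⁻¹ : ℚ_[p])‖ = 1) :
    classGroupChiCard ℚ K₁ p (fun g => ((θ₁ g : ℤ_[p]ˣ) : ℤ_[p])) = 1 :=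
  classGroupChiCard_eq_one_of_norm_generalizedBernoulli_eq_one_subfield' M θ₁ χ m
    (isDirichletAvatar_comp_restrictNormalHom θ₁ χ hθχ) hχ1 hb hB

/-- **The consumers' lemma for `K₁ ⊆ ℚ(μ_f)`, avatar on `ℚ(μ_f)`.** As the next theorem (the
hypotheses of the named fact VERBATIM: `p ∤ [K₁ : ℚ]`, `χ` primitive, odd, «`χ ≠ ω`»,
`‖B_{1,χ⁻¹}‖_p = 1`), except that the Dirichlet avatar `χ` is required only for the inflated character
`θ_M = θ₁ ∘ (σ ↦ σ|_{K₁})` of `Gal(M/ℚ)`, `M = ℚ(μ_f)` — the form used when `K₁ = K^{ker θ}` is cut out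
of a bigger abelian field `K` (fifth file). Lang's Lemma 1 (ii) exactly as there.
[cite: Lang1990, Ch. 1 §3 Thm. 3.1, Lemma 1 (ii), Cor. 1, proof of Cor. 3] [cite: Washington1997, Thm. 6.10]
[cite: Solomon1990, §I pp. 467–468, Rem. II.1 (a) p. 472] -/
theorem classGroupChiCard_eq_one_of_norm_generalizedBernoulli_eq_one_subfield_of_odd'
    (M : Type) [Field M] [NumberField M] [Algebra K₁ M] [IsCyclotomicExtension {f} ℚ M]
    (hK₁ : ¬ p ∣ Module.finrank ℚ K₁) (θ₁ : (K₁ ≃ₐ[ℚ] K₁) →* ℤ_[p]ˣ) (χ : DirichletCharacter ℚ_[p] f)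
    (m : ℕ) (hχ : χ.IsPrimitive)
    (hθχ : IsDirichletAvatar M (θ₁.comp (AlgEquiv.restrictNormalHom (K₁ := M) K₁)) χ m) (hodd : χ.Odd)
    (hω : ¬ (f = p ∧ ∀ a : ℤ, ¬ ((p : ℤ) ∣ a) → ‖χ (a : ZMod f) - (a : ℚ_[p])‖ < 1))
    (hB : ‖(generalizedBernoulli 1 χ⁻¹ : ℚ_[p])‖ = 1) :
    classGroupChiCard ℚ K₁ p (fun g => ((θ₁ g : ℤ_[p]ˣ) : ℤ_[p])) = 1 := by
  haveI : IsGalois ℚ M := IsCyclotomicExtension.isGalois {f} ℚ M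
  have hp : p.Prime := Fact.out
  -- `χ` odd ⟹ `χ ≠ 1`
  have hχ1 : χ ≠ 1 := by
    rintro rfl
    have h := hodd
    rw [DirichletCharacter.Odd, MulChar.one_apply isUnit_one.neg] at h
    have h2 : (2 : ℚ_[p]) = 0 := by linear_combination h
    exact two_ne_zero h2
  refine classGroupChiCard_eq_one_of_norm_generalizedBernoulli_eq_one_subfield' M θ₁ χ m hθχ hχ1 ?_ hB
  -- the values of `χ` at units are values of `θ₁`: `N`-th roots of unity, `N = |Gal(K₁/ℚ)|` prime to `p`
  have hN : ¬ p ∣ Fintype.card (K₁ ≃ₐ[ℚ] K₁) := by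
    rwa [← Nat.card_eq_fintype_card, IsGalois.card_aut_eq_finrank]
  have hdict : ∀ σ : M ≃ₐ[ℚ] M, (((θ₁ (σ.restrictNormal K₁) : ℤ_[p]ˣ) : ℤ_[p]) : ℚ_[p]) =
      χ ((IsCyclotomicExtension.Rat.galEquivZMod f M σ : (ZMod f)ˣ) : ZMod f) := fun σ =>
    coe_apply_eq_dirichlet_of_isDirichletAvatar (θ₁.comp (AlgEquiv.restrictNormalHom (K₁ := M) K₁)) χ
      hθχ σ
  have hχpow : ∀ u : (ZMod f)ˣ, χ (u : ZMod f) ^ Fintype.card (K₁ ≃ₐ[ℚ] K₁) = 1 := by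
    intro u
    obtain ⟨σ, hσ⟩ := (IsCyclotomicExtension.Rat.galEquivZMod f M).surjective u
    rw [← hσ, ← hdict σ, ← PadicInt.coe_pow, ← Units.val_pow_eq_pow_val, ← map_pow, pow_card_eq_one,
      map_one, Units.val_one, PadicInt.coe_one]
  have hχnorm : ∀ u : (ZMod f)ˣ, ‖χ (u : ZMod f)‖ = 1 := by
    intro u
    have h2 := congrArg norm (hχpow u)
    rw [norm_pow, norm_one] at h2
    exact (pow_eq_one_iff_of_nonneg (norm_nonneg _) Fintype.card_ne_zero).mp h2
  -- Lang's Lemma 1 (ii), by contradiction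
  by_contra hnb
  push Not at hnb
  have hlt : ∀ b : ℕ, b < f → b.Coprime f → ‖χ (b : ZMod f) - (b : ℚ_[p])‖ < 1 := by
    intro b hbf hb
    refine lt_of_le_of_ne ?_ (hnb b hbf hb)
    have hu : IsUnit (b : ZMod f) := (ZMod.isUnit_iff_coprime b f).mpr hb
    calc ‖χ (b : ZMod f) - (b : ℚ_[p])‖ ≤ max ‖χ (b : ZMod f)‖ ‖-(b : ℚ_[p])‖ := by
          rw [sub_eq_add_neg]
          exact Padic.nonarchimedean _ _
      _ ≤ 1 := by
          rw [norm_neg, ← hu.unit_spec, hχnorm]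
          exact max_le le_rfl (by exact_mod_cast Padic.norm_int_le_one (b : ℤ))
  -- `f ≥ 2` (`χ ≠ 1`)
  have hf2 : 2 ≤ f := by
    by_contra hf
    have hf1 : f = 1 := by have := NeZero.pos f; omega
    exact hχ1 ((DirichletCharacter.eq_one_iff_conductor_eq_one (χ := χ)).mpr
      (Nat.dvd_one.mp (hf1 ▸ χ.conductor_dvd_level)))
  -- `p ∣ f` (take `b = f − 1`: `χ(−1) = −1` is forced only through `‖χ(f−1) − (f−1)‖ = ‖f‖`)
  have hpf : p ∣ f := by
    by_contra hpf
    have hcop : (f - 1).Coprime f := by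
      rw [Nat.coprime_self_sub_left (by omega)]
      exact Nat.coprime_one_left f
    have h1 := hlt (f - 1) (by omega) hcop
    have hneg : ((f - 1 : ℕ) : ZMod f) = -1 := by
      rw [Nat.cast_sub (by omega), Nat.cast_one, ZMod.natCast_self, zero_sub]
    rw [hneg, hodd, Nat.cast_sub (by omega), Nat.cast_one, show (-1 : ℚ_[p]) - ((f : ℚ_[p]) - 1) = -(f : ℚ_[p]) by ring,
      norm_neg] at h1
    exact hpf (Padic.norm_natCast_lt_one_iff.mp h1)
  -- `χ` is trivial on the units `≡ 1 (mod p)`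
  have hker : (ZMod.unitsMap hpf).ker ≤ χ.toUnitHom.ker := by
    intro x hx
    rw [MonoidHom.mem_ker] at hx ⊢
    set b : ℕ := ((x : (ZMod f)ˣ) : ZMod f).val with hbdef
    have hbx : (b : ZMod f) = (x : ZMod f) := ZMod.natCast_zmod_val _
    have hbcop : b.Coprime f := ZMod.val_coe_unit_coprime x
    have hbf : b < f := ZMod.val_lt _
    have hb1 : (b : ZMod p) = 1 := by
      have h1 := congrArg (fun u : (ZMod p)ˣ => (u : ZMod p)) hx
      simp only [ZMod.unitsMap_val, Units.val_one] at h1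
      rw [← hbx, ZMod.cast_natCast hpf] at h1
      exact h1
    have hnb1 : ‖(b : ℚ_[p]) - 1‖ < 1 := by
      have hdvd : (p : ℤ) ∣ (b : ℤ) - 1 := by
        rw [← ZMod.intCast_zmod_eq_zero_iff_dvd]
        push_cast
        rw [hb1, sub_self]
      have h2 := Padic.norm_intCast_lt_one_iff.mpr hdvd
      push_cast at h2
      exact h2
    have hζ : ‖χ (b : ZMod f) - 1‖ < 1 := by
      calc ‖χ (b : ZMod f) - 1‖ = ‖(χ (b : ZMod f) - b) + ((b : ℚ_[p]) - 1)‖ := by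
            rw [sub_add_sub_cancel]
        _ ≤ max ‖χ (b : ZMod f) - b‖ ‖(b : ℚ_[p]) - 1‖ := Padic.nonarchimedean _ _
        _ < 1 := max_lt (hlt b hbf hbcop) hnb1
    have hpow : χ (b : ZMod f) ^ Fintype.card (K₁ ≃ₐ[ℚ] K₁) = 1 := by
      rw [hbx]
      exact hχpow x
    have hone := eq_one_of_pow_eq_one_of_norm_sub_one_lt hpow hN hζ
    rw [hbx] at hone
    exact Units.ext (by rw [MulChar.coe_toUnitHom, hone, Units.val_one])
  have hfact : χ.FactorsThrough p :=
    (DirichletCharacter.factorsThrough_iff_ker_unitsMap (χ := χ) hpf).mpr hker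
  have hcond : χ.conductor ∣ p :=
    (DirichletCharacter.mem_conductorSet_iff_conductor_dvd χ hpf).mp hfact
  rw [hχ] at hcond
  rcases (Nat.dvd_prime hp).mp hcond with hf1 | hfp
  · omega
  · refine hω ⟨hfp, fun a ha => ?_⟩
    set b : ℕ := ((a : ℤ) : ZMod f).val with hbdef
    have hbz : (b : ZMod f) = ((a : ℤ) : ZMod f) := ZMod.natCast_zmod_val _
    have hbf : b < f := ZMod.val_lt _
    have hunit : IsUnit ((a : ℤ) : ZMod f) := by
      subst hfp
      have hne : ((a : ℤ) : ZMod f) ≠ 0 := by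
        rwa [Ne, ZMod.intCast_zmod_eq_zero_iff_dvd]
      exact hne.isUnit
    have hbcop : b.Coprime f := (ZMod.isUnit_iff_coprime b f).mp (hbz ▸ hunit)
    have h1 := hlt b hbf hbcop
    rw [hbz] at h1
    have hba : ‖(b : ℚ_[p]) - (a : ℚ_[p])‖ < 1 := by
      have hdvd : (p : ℤ) ∣ (b : ℤ) - a := by
        have h2 : ((a : ℤ) : ZMod f) = ((b : ℤ) : ZMod f) := by
          rw [← hbz]
          push_cast
          rfl
        rw [ZMod.intCast_eq_intCast_iff_dvd_sub, hfp] at h2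
        exact h2
      have h2 := Padic.norm_intCast_lt_one_iff.mpr hdvd
      push_cast at h2
      exact h2
    calc ‖χ ((a : ℤ) : ZMod f) - (a : ℚ_[p])‖
        = ‖(χ ((a : ℤ) : ZMod f) - b) + ((b : ℚ_[p]) - a)‖ := by rw [sub_add_sub_cancel]
      _ ≤ max ‖χ ((a : ℤ) : ZMod f) - b‖ ‖(b : ℚ_[p]) - a‖ := Padic.nonarchimedean _ _
      _ < 1 := max_lt h1 hba

/-- **The consumers' lemma made unconditional for EVERY subfield of `ℚ(μ_f)`.** `K₁ ⊆ M = ℚ(μ_f)`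
(`[Algebra K₁ M] [IsCyclotomicExtension {f} ℚ M]`), `K₁/ℚ` Galois with `p ∤ [K₁ : ℚ]` — NO hypothesis on
`[M : K₁]` — `θ₁ : Gal(K₁/ℚ) →* ℤ_pˣ` with PRIMITIVE `ℚ_p`-valued Dirichlet avatar `χ` mod `f`, `χ` odd,
«`χ ≠ ω`» spelled `¬ (f = p ∧ ∀ a, p ∤ a → ‖χ(a) − a‖_p < 1)`, `‖B_{1,χ⁻¹}‖_p = 1` ⟹
`#e_{θ₁}(ℤ_p ⊗ Cl K₁) = 1`. Same shape as the conditional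
`classGroupChiCard_eq_one_of_norm_generalizedBernoulli_eq_one` of `ImaginaryAbelianClassGroupOddPartBernoulli.lean`
with `(h : MazurWiles1984.thm2_…)` REMOVED and `K₁ ⊆ ℚ(μ_f)` ADDED. Lang's Lemma 1 (ii) supplies
`b < f`: if every `b < f` prime to `f` had `χ(b) ≡ b (mod p)`, then `b = f − 1` gives `p ∣ f`
(`χ(−1) = −1`), the units `≡ 1 (mod p)` lie in `ker χ` (the values of `χ` are values of `θ₁`, of order
dividing `|Gal(K₁/ℚ)| = [K₁:ℚ]`, prime to `p`, and such a root of unity `≡ 1 (mod p)` is `1`), so `χ`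
factors through `(ℤ/p)ˣ`, `f = p` by primitivity, and `χ(a) ≡ a (mod p)` for all `a` — excluded.
[cite: Lang1990, Ch. 1 §3 Thm. 3.1, Lemma 1 (ii), Cor. 1, proof of Cor. 3] [cite: Washington1997, Thm. 6.10]
[cite: Solomon1990, §I pp. 467–468, Rem. II.1 (a) p. 472] -/
theorem classGroupChiCard_eq_one_of_norm_generalizedBernoulli_eq_one_subfield_of_odd
    (M : Type) [Field M] [NumberField M] [Algebra K₁ M] [IsCyclotomicExtension {f} ℚ M]
    (hK₁ : ¬ p ∣ Module.finrank ℚ K₁) (θ₁ : (K₁ ≃ₐ[ℚ] K₁) →* ℤ_[p]ˣ) (χ : DirichletCharacter ℚ_[p] f)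
    (m : ℕ) (hχ : χ.IsPrimitive) (hθχ : IsDirichletAvatar K₁ θ₁ χ m) (hodd : χ.Odd)
    (hω : ¬ (f = p ∧ ∀ a : ℤ, ¬ ((p : ℤ) ∣ a) → ‖χ (a : ZMod f) - (a : ℚ_[p])‖ < 1))
    (hB : ‖(generalizedBernoulli 1 χ⁻¹ : ℚ_[p])‖ = 1) :
    classGroupChiCard ℚ K₁ p (fun g => ((θ₁ g : ℤ_[p]ˣ) : ℤ_[p])) = 1 :=
  classGroupChiCard_eq_one_of_norm_generalizedBernoulli_eq_one_subfield_of_odd' M hK₁ θ₁ χ m hχ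
    (isDirichletAvatar_comp_restrictNormalHom θ₁ χ hθχ) hodd hω hB

end CyclotomicSubfield

end Literature.NumberTheory.NumberFields

end
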